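import Literature.Topology.PlanarFoliations.ChainNear
import Literature.Topology.PlanarFoliations.ProngStarEnds
import HarnessLib

/-!
# Prongs swept by the compact leaves of a chain are in the frontier of the limit set

Topic: Topology / PlanarFoliations, sequel to `ChainNear.lean` (limit points of the curves
`ι (K n)`, `n → ∞`, of a strictly decreasing chain of discs are frontier points of the limit set
`Dlim`) and `ProngStarEnds.lean` (the horizontals `horiz j h β` of the sectors of a prong star).
**If compact leaves `K n` with arbitrarily large `n` contain whole horizontals of the sector `j`
at heights arbitrarily close to `0`, then the prong of the sector lies in the frontier of the
limit set** (`pt_mem_frontier_Dlim_of_horiz`): each prong point `pt j (b, 0)` is the limit of the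
points `pt j (b, h)` of those horizontals.

All statements are [folklore].
-/

noncomputable section

open Set Filter Function Metric
open _root_.Topology
open Literature.Topology.FourManifolds Literature.Topology.FourManifolds.Foliation

namespace Literature.Topology.PlanarFoliations

namespace ProngStar

variable {X : Type*} [TopologicalSpace X] [T2Space X] [SecondCountableTopology X] [Nonempty X] {F : Foliation ℝ X}
  {ι : X → ℂ} {v : ℂ} {n : ℕ} (P : ProngStar F ι v n) (hbi : IsBiOriented F) (hι : IsOpenEmbedding ι)
  {K : ℕ → X} (hK : ∀ n, IsCompact (F.leaf (K n))) (hdec : ∀ n, discLeaf F ι (K (n + 1)) ⊂ discLeaf F ι (K n))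

include hbi hK hdec in
/-- **Prongs swept by the curves of the chain are frontier prongs of the limit set.** [folklore] -/
theorem pt_mem_frontier_Dlim_of_horiz {j : ZMod n}
    (hpass : ∀ N, ∀ δ > (0 : ℝ), ∃ m ≥ N, ∃ h : ℝ, h ≠ 0 ∧ |h| < δ ∧ ∀ β ∈ Icc 0 P.ρ, P.horiz hι j h β ∈ F.leaf (K m))
    {b : ℝ} (hb : b ∈ Ioc 0 P.ρ) : P.pt j (b, 0) ∈ frontier (Dlim ι F K) := by
  refine mem_frontier_Dlim_of_clusterPt hbi hι hK hdec fun N ↦ ?_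
  rw [Metric.mem_closure_iff]
  intro ε hε
  -- continuity of `pt j` at `(b, 0)` within the half square
  have hr₀ : ((b, (0 : ℝ)) : ℝ × ℝ) ∈ P.rect := (P.mem_rect_iff).2 ⟨⟨hb.1.le, hb.2⟩, by simp [P.ρ_pos.le]⟩
  have hcont := (P.continuousOn_pt j) _ hr₀
  obtain ⟨δ, hδ, hclose⟩ := (Metric.continuousWithinAt_iff.1 hcont) ε hε
  obtain ⟨m, hm, h, hh0, hhδ, hhor⟩ := hpass N (min δ P.ρ) (lt_min hδ P.ρ_pos)
  have hhI : h ∈ Icc (-P.ρ) P.ρ := by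
    have := hhδ.trans_le (min_le_right _ _); rw [abs_lt] at this; exact ⟨this.1.le, this.2.le⟩
  have hr : ((b, h) : ℝ × ℝ) ∈ P.rect := (P.mem_rect_iff).2 ⟨⟨hb.1.le, hb.2⟩, hhI⟩
  have hne : ((b, h) : ℝ × ℝ) ≠ 0 := fun h0 ↦ hh0 (congrArg Prod.snd h0)
  refine ⟨P.pt j (b, h), mem_iUnion₂.2 ⟨m, hm, P.horiz hι j h b, hhor b ⟨hb.1.le, hb.2⟩, P.ι_horiz hι hr hne⟩, ?_⟩
  rw [dist_comm]
  refine hclose hr ?_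
  rw [Prod.dist_eq, dist_self, Real.dist_eq, sub_zero]
  exact max_lt hδ (hhδ.trans_le (min_le_left _ _))

end ProngStar

end Literature.Topology.PlanarFoliations
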